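import Summits.FinalStateConjecture.FinalStateConjecture.Theorems.SwallowTheDatumUniversalWitnessFamilyStubSchwOutSiteAux2
import Summits.FinalStateConjecture.FinalStateConjecture.Theorems.SwallowTheDatumParametricKerrBurialEngine
import HarnessLib

/-!
# Stub `stub_schwOutSite` of the line `Sketch` (crux `SwallowTheDatum.UniversalWitnessFamily`,
# item stmt-FinalStateConjecture-10051): the Schwarzschild far field is an admissible OUT-site

The stub `stub_schwOutSite` of skeleton v6 of the line `Sketch` (conjunct 3 of the sibling crux 10052's
`stub_explicit`, verbatim): for a bump `η` and thresholds `εo, μo, μ₀ > 0` there are a mass `0 < m ≤ μ₀`, a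
deviation bound `sOut` and a margin `θ > 0` such that for EVERY datum `S` with `SchwDatum m S` (exactly
time-symmetric isotropic Schwarzschild(`m`) off `B_{1/4}`) the hypothesis block `MOTHyp` of Mao–Oh–Tao Thm 1.7
(`SwallowTheDatumParametricKerrBurialEngine.lean`) holds with OUT = `(S.coordH, S.coordK)` read on `A_32` against
ANY in-fields of `C² × C¹` deviation and averaged charges at most `θ` — the predicate `SchwOutSite η εo μo m sOut θ`
(Mao–Oh–Tao arXiv:2308.13031, Rem 1.11).

Proof (helper files `…StubSchwOutSiteAux1.lean`, `…Aux2.lean`): the OUT-charges are `P = J = 0` (the weight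
`η_32` lives where `k = 0`), `C = 0` (odd integrand), `12 m ≤ E ≤ 48 m` (radial integration, `E ≈ 8πm`) once
`m ∫|η| ≤ 8`, and the OUT-deviation is `≤ c·m` for the absolute constant `c` of `exists_devBound`; with
`m := min (min μ₀ 1) (min (8/∫|η|) (min (εo²/100) (μo/c²)))`, `θ := min m (μo m)/2`, `sOut := c·m` the five
inequalities of Thm 1.7 are elementary (`schwOut_five_ineq`: `ΔE ∈ [11.5 m, 48.5 m]`, `Σ ΔP² ≤ 3θ²`, …).

References: Mao–Oh–Tao arXiv:2308.13031 Thm 1.7, Rem 1.11; the crux directory's `PICKED.md`; the skeleton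
`Cruxes/UniversalWitnessFamily/Lines/Sketch.lean`.
-/

-- `Summit.<Summit>.<Problem>` is the tree's mandated summit-side namespace (CONVENTIONS §2); for this
-- single-conjunct summit the two coincide, so the duplicate is deliberate.
set_option linter.dupNamespace false

noncomputable section

-- instance search through the nested operator types `E3 →L E3 →L ℝ`
set_option maxSynthPendingDepth 3

namespace Summit.FinalStateConjecture.FinalStateConjecture.Theorems.SwallowTheDatum.UniversalWitnessFamily

open scoped Manifold ContDiff Topology BigOperators InnerProductSpace
open Set Filter Function MeasureTheory Literature.Geometry.Lorentzian
open Literature.Geometry.Lorentzian.MaoOhTao Literature.Geometry.Lorentzian.InitialDataSet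
open Summit.FinalStateConjecture.FinalStateConjecture.Theorems.SwallowTheDatum.ParametricKerrBurial
  (SchwOutSite SchwDatum MOTHyp schwField VacAt)

/-! ## The coefficient fields of a Schwarzschild datum -/

/-- The metric field of a Schwarzschild(`m`) datum is `(1 + m/(2‖y‖))⁴ • δ` off `B_{1/4}`. [folklore] -/
theorem coordH_eq_of_schwDatum {m : ℝ} {S : InitialDataSet (𝓡 3) E3} (hS : SchwDatum m S) :
    ∀ y : E3, 1 / 4 < ‖y‖ → S.coordH y = (1 + m / (2 * ‖y‖)) ^ 4 • (innerSL ℝ : E3 →L[ℝ] E3 →L[ℝ] ℝ) := by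
  intro y hy
  ext v w
  simp [coordH_apply, (hS.1 y hy).1 v w, innerSL_apply_apply (𝕜 := ℝ)]

/-- The second fundamental form of a Schwarzschild(`m`) datum vanishes off `B_{1/4}`. [folklore] -/
theorem coordK_eq_of_schwDatum {m : ℝ} {S : InitialDataSet (𝓡 3) E3} (hS : SchwDatum m S) :
    ∀ y : E3, 1 / 4 < ‖y‖ → S.coordK y = 0 :=
  fun y hy ↦ (hS.1 y hy).2

/-! ## The five inequalities of Thm 1.7: bookkeeping -/

/-- A sum of three squares of numbers of modulus `≤ θ` is at most `(2θ)²`, so its root is at most `2θ`.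
[folklore] -/
theorem schwOut_sqrt_sum_sq_le {P : Fin 3 → ℝ} {θ : ℝ} (hθ : 0 ≤ θ) (hP : ∀ i, |P i| ≤ θ) :
    ∑ i, P i ^ 2 ≤ 3 * θ ^ 2 ∧ Real.sqrt (∑ i, P i ^ 2) ≤ 2 * θ := by
  have h : ∀ i, P i ^ 2 ≤ θ ^ 2 := fun i ↦ by
    rw [← sq_abs]
    exact pow_le_pow_left₀ (abs_nonneg _) (hP i) 2
  have hs : ∑ i, P i ^ 2 ≤ 3 * θ ^ 2 := by
    rw [Fin.sum_univ_three]
    linarith [h 0, h 1, h 2]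
  refine ⟨hs, ?_⟩
  calc Real.sqrt (∑ i, P i ^ 2) ≤ Real.sqrt ((2 * θ) ^ 2) := Real.sqrt_le_sqrt (by nlinarith)
    _ = 2 * θ := Real.sqrt_sq (by positivity)

/-- **The five inequalities of Mao–Oh–Tao Thm 1.7 for the Schwarzschild OUT-site**, as real arithmetic: with
OUT-charges `P = C = J = 0`, `E ∈ [12m, 48m]`, OUT-deviation `c·m`, IN-charges and IN-deviation `≤ θ`, and the
choices `m ≤ min 1 (εo²/100) (μo/c²)`, `θ ≤ min (m/2) (μo m/2)`. [folklore] -/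
theorem schwOut_five_ineq {εo μo m θ c E Ein sIn : ℝ} {Pout Pin Cout Cin Jout Jin : Fin 3 → ℝ}
    (hμo : 0 < μo) (hm : 0 < m) (hm1 : m ≤ 1) (hmε : m ≤ εo ^ 2 / 100) (hc : 0 < c)
    (hmc : m ≤ μo / c ^ 2) (hθ : 0 < θ) (hθm : θ ≤ m / 2) (hθμ : θ ≤ μo * m / 2)
    (hE1 : 12 * m ≤ E) (hE2 : E ≤ 48 * m) (hEin : |Ein| ≤ θ)
    (hPout : ∀ i, Pout i = 0) (hCout : ∀ i, Cout i = 0) (hJout : ∀ i, Jout i = 0)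
    (hPin : ∀ i, |Pin i| ≤ θ) (hCin : ∀ i, |Cin i| ≤ θ) (hJin : ∀ i, |Jin i| ≤ θ)
    (hs0 : 0 ≤ sIn) (hs1 : sIn ≤ θ) :
    Real.sqrt (∑ i, (Pout i - Pin i) ^ 2) < E - Ein ∧
    E - Ein < 2 * Real.sqrt ((E - Ein) ^ 2 - ∑ i, (Pout i - Pin i) ^ 2) ∧
    E - Ein < εo ^ 2 ∧
    Real.sqrt (∑ i, (Cout i - Cin i) ^ 2) + Real.sqrt (∑ i, (Jout i - Jin i) ^ 2) < μo * (E - Ein) ∧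
    sIn ^ 2 + (c * m) ^ 2 < μo * (E - Ein) := by
  -- the differences are minus the in-charges
  have hP' : ∀ i, |Pout i - Pin i| ≤ θ := fun i ↦ by rw [hPout i, zero_sub, abs_neg]; exact hPin i
  have hC' : ∀ i, |Cout i - Cin i| ≤ θ := fun i ↦ by rw [hCout i, zero_sub, abs_neg]; exact hCin i
  have hJ' : ∀ i, |Jout i - Jin i| ≤ θ := fun i ↦ by rw [hJout i, zero_sub, abs_neg]; exact hJin i
  obtain ⟨hPs, -⟩ := schwOut_sqrt_sum_sq_le hθ.le hP'
  obtain ⟨-, hCr⟩ := schwOut_sqrt_sum_sq_le hθ.le hC'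
  obtain ⟨-, hJr⟩ := schwOut_sqrt_sum_sq_le hθ.le hJ'
  -- the energy difference
  rw [abs_le] at hEin
  have hΔ1 : 11 * m ≤ E - Ein := by linarith
  have hΔ2 : E - Ein ≤ 49 * m := by linarith
  have hΔ0 : 0 < E - Ein := by linarith
  set Δ := E - Ein with hΔ_def
  set SP := ∑ i, (Pout i - Pin i) ^ 2 with hSP_def
  have hSP0 : 0 ≤ SP := Finset.sum_nonneg fun i _ ↦ sq_nonneg _
  have hSP1 : SP < m ^ 2 := by nlinarith
  have hm2 : m ^ 2 ≤ Δ ^ 2 / 121 := by nlinarith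
  refine ⟨?_, ?_, ?_, ?_, ?_⟩
  · -- (1) `|ΔP| < ΔE`
    rw [Real.sqrt_lt' hΔ0]
    nlinarith
  · -- (2) `ΔE < 2 √(ΔE² − |ΔP|²)`
    have h : Δ / 2 < Real.sqrt (Δ ^ 2 - SP) := by
      rw [Real.lt_sqrt (by positivity)]
      nlinarith
    linarith
  · -- (3) `ΔE < εo²`
    nlinarith
  · -- (4) `|ΔC| + |ΔJ| < μo ΔE`
    have h1 : Real.sqrt (∑ i, (Cout i - Cin i) ^ 2) + Real.sqrt (∑ i, (Jout i - Jin i) ^ 2) ≤ 4 * θ := by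
      linarith
    have h2 : 4 * θ ≤ 2 * (μo * m) := by linarith
    have h3 : 2 * (μo * m) < μo * Δ := by nlinarith
    linarith
  · -- (5) `sIn² + sOut² < μo ΔE`
    have h1 : sIn ^ 2 ≤ θ ^ 2 := pow_le_pow_left₀ hs0 hs1 2
    have h2 : θ ^ 2 ≤ μo * m / 4 := by
      have : θ * θ ≤ (m / 2) * (μo * m / 2) := mul_le_mul hθm hθμ hθ.le (by positivity)
      nlinarith
    have h3 : (c * m) ^ 2 ≤ μo * m := by
      have hc2 : 0 < c ^ 2 := by positivity
      have : c ^ 2 * m ≤ μo := by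
        calc c ^ 2 * m ≤ c ^ 2 * (μo / c ^ 2) := mul_le_mul_of_nonneg_left hmc hc2.le
          _ = μo := by field_simp
      nlinarith
    have h4 : μo * m / 4 + μo * m < μo * Δ := by nlinarith
    linarith

/-! ## The stub -/

/-- **Stub `stub_schwOutSite` (S3c of the line `Sketch`; conjunct 3 of crux 10052's `stub_explicit` verbatim): the
exact Schwarzschild(`m`) far field at radius `32` is a Thm-1.7 OUT-site against every in-pair of deviation and
charges `≤ θ`.**  Choices: `c` the absolute constant of `exists_devBound`, `K = ∫|η|`,
`m = min (min μ₀ 1) (min (8/K) (min (εo²/100) (μo/c²)))`, `θ = min m (μo m)/2`, `sOut = c·m`; then for every `S`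
with `SchwDatum m S`: `P_out = J_out = C_out = 0`, `12 m ≤ E_out ≤ 48 m` (`avgE32_bounds`),
`DevLE S.coordH S.coordK 32 64 (c·m)` (`devLE_of_agree`), and `schwOut_five_ineq` closes `MOTHyp`. -/
theorem stub_schwOutSite :
  ∀ η : ℝ → ℝ, IsBump η → ∀ (εo μo μ₀ : ℝ), 0 < εo → 0 < μo → 0 < μ₀ →
    ∃ (m sOut θ : ℝ), 0 < m ∧ m ≤ μ₀ ∧ 0 < θ ∧ SchwOutSite η εo μo m sOut θ := by
  intro η hη εo μo μ₀ _ hμo hμ₀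
  obtain ⟨c, hc, hdev⟩ := exists_devBound
  set K : ℝ := ∫ s, |η s| with hK_def
  have hK : 1 ≤ K := schwOut_one_le_integral_abs hη
  have hK0 : 0 < K := by linarith
  set m : ℝ := min (min μ₀ 1) (min (8 / K) (min (εo ^ 2 / 100) (μo / c ^ 2))) with hm_def
  have hm0 : 0 < m := by
    simp only [hm_def, lt_min_iff]
    exact ⟨⟨hμ₀, one_pos⟩, by positivity, by positivity, by positivity⟩
  have hmμ₀ : m ≤ μ₀ := (min_le_left _ _).trans (min_le_left _ _)
  have hm1 : m ≤ 1 := (min_le_left _ _).trans (min_le_right _ _)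
  have hmK : m ≤ 8 / K := (min_le_right _ _).trans (min_le_left _ _)
  have hmε : m ≤ εo ^ 2 / 100 := ((min_le_right _ _).trans (min_le_right _ _)).trans (min_le_left _ _)
  have hmc : m ≤ μo / c ^ 2 := ((min_le_right _ _).trans (min_le_right _ _)).trans (min_le_right _ _)
  have hmK' : m * K ≤ 8 := by rwa [← le_div_iff₀ hK0]
  set θ : ℝ := min m (μo * m) / 2 with hθ_def
  have hθ0 : 0 < θ := by
    simp only [hθ_def]
    exact div_pos (lt_min hm0 (by positivity)) two_pos
  have hθm : θ ≤ m / 2 := by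
    simp only [hθ_def]
    linarith [min_le_left m (μo * m)]
  have hθμ : θ ≤ μo * m / 2 := by
    simp only [hθ_def]
    linarith [min_le_right m (μo * m)]
  refine ⟨m, c * m, θ, hm0, hmμ₀, hθ0, ?_⟩
  intro S hS gIn kIn sIn hdevIn hs0 hs1 hEin hPin hCin hJin
  have hg := coordH_eq_of_schwDatum hS
  have hk := coordK_eq_of_schwDatum hS
  obtain ⟨hE1, hE2⟩ := avgE32_bounds hη hg hm0 hm1 hmK'
  refine ⟨hdevIn, devLE_of_agree hdev hm0.le hm1 hg hk, ?_⟩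
  exact schwOut_five_ineq hμo hm0 hm1 hmε hc hmc hθ0 hθm hθμ hE1 hE2 hEin
    (avgP32_eq_zero hη hk) (avgC32_eq_zero hη hg) (avgJ32_eq_zero hη hk) hPin hCin hJin hs0 hs1

end Summit.FinalStateConjecture.FinalStateConjecture.Theorems.SwallowTheDatum.UniversalWitnessFamily

end
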